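import Mathlib
import Literature.Computability.AlgebraicComplexity.StandardFamilies
import Literature.Computability.AlgebraicComplexity.StandardFamiliesProofs
import Literature.Computability.AlgebraicComplexity.PermanentIrreducible

/-!
# Crux `WordLengthQP` (stmt-ValiantsHypothesis-6623), line `positive-monoid-exits` —
stub `stub_kappaGeTwo`: rung 1 of the sign budget (`κ(per_n) ≥ 2` for `n ≥ 2`)

A real affine elementary word of width 3 is a list of letters
`l = (i, j, c, o) : Fin 3 × Fin 3 × ℝ × Option σ` with matrix `E_ij(c)` (`o = none`) or
`E_ij(c · x_v)` (`o = some v`), i.e. `Matrix.transvection i j (C c * o.elim 1 X)`; the value of a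
word is the product of its letter matrices, and its EXITS (from Lusztig's positive monoid) are the
letters that are NOT (positive coefficient `c > 0` and adjacent, `|i - j| = 1`).

**Rung 1.** For `n ≥ 2`, every real word computing `E₀₂(per_n)` has at least two exits
(sharp: `E₀₂(per₁)` is one far letter).  The proof is uniform and does not use total
nonnegativity, only coefficientwise nonnegativity:

* FACT A (`kgt_adj_mul_S_mul_adj`): with `S = diag(1, -1, 1)`, every ADJACENT letter `T` (any
  sign) satisfies `T S T = S`, so a stretch `P = T₁ ⋯ T_k` of adjacent letters has the two-sided
  inverse `S P^rev S`, `P^rev = T_k ⋯ T₁` (`kgt_prod_mul_S_mul_rev`).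
* FACT B (`kgt_isolate`): if the word had at most one exit, write it as `P₀ L P₁` around the exit
  (or the head) `L`, all other letters positive adjacent; then `S L S = P₀^rev E₀₂(per_n) P₁^rev`
  (`S E₀₂ S = E₀₂`).
* FACT C (`kgt_coeff_le_conj`): a positive letter is `1 + N` with `N` coefficientwise
  nonnegative, hence so is every `P^rev`; with `E₀₂(per_n)` coefficientwise nonnegative, every
  coefficient of the `(0, 2)` entry of `P₀^rev E₀₂(per_n) P₁^rev` dominates the corresponding
  coefficient of `per_n`.
* FACT D: the `(0, 2)` entry of `S L S` is `0` or `c · (1 or x_v)`, supported in degrees `≤ 1`,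
  while the diagonal monomial `x₀₀ ⋯ x_{n-1,n-1}` (degree `n ≥ 2`) has coefficient `1` in `per_n`
  (`coeff_permMonomial_perPoly`): `0 ≥ 1`, contradiction.

References: the `S`-conjugation `P ↦ S P⁻¹ S` preserving positivity is [FallatJohnson2011]
Thm 1.1.1 / Thm 1.3.3 (background only; no total nonnegativity is used here); elementary words for
polynomials are [BenOrCleve1992].  Design: all helper lemmas are stated for lists of matrices over
a commutative ring (FACT A, B) or over `MvPolynomial σ ℝ` (FACT C), the letters enter only through
the per-letter facts; nothing here is specific to the permanent beyond `coeff_perPoly ≥ 0` and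
`coeff_permMonomial_perPoly = 1`.
-/

-- `Summit.ValiantsHypothesis.ValiantsHypothesis.…` is the tree's mandated single-conjunct layout
-- (Sub = Summit), so the duplicated namespace component is intended.
set_option linter.dupNamespace false

noncomputable section

namespace Summit.ValiantsHypothesis.ValiantsHypothesis.Cruxes.WordLengthQP.PositiveMonoidExits

open Literature.Computability.AlgebraicComplexity

/-! ## FACT A: adjacent letters are inverted by conjugation with `S = diag(1, -1, 1)` -/

/-- `S² = 1` for `S = diag(1, -1, 1)`. [folklore] -/
private theorem kgt_S_mul_S {R : Type*} [CommRing R] :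
    Matrix.diagonal ![(1 : R), -1, 1] * Matrix.diagonal ![(1 : R), -1, 1] = 1 := by
  ext i j
  fin_cases i <;> fin_cases j <;> simp

/-- FACT A: for an ADJACENT transvection `T = E_ij(a)` (`|i - j| = 1`, any `a`), `T S T = S`,
i.e. `S T S = T⁻¹`. [folklore] -/
private theorem kgt_adj_mul_S_mul_adj {R : Type*} [CommRing R] (i j : Fin 3)
    (hij : i.val + 1 = j.val ∨ j.val + 1 = i.val) (a : R) :
    Matrix.transvection i j a * Matrix.diagonal ![(1 : R), -1, 1] * Matrix.transvection i j a =
      Matrix.diagonal ![(1 : R), -1, 1] := by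
  fin_cases i <;> fin_cases j <;> simp at hij <;>
  · ext k l
    fin_cases k <;> fin_cases l <;>
      simp [Matrix.transvection, Matrix.mul_apply, Fin.sum_univ_three, Matrix.one_apply]

/-- `S E₀₂(f) S = E₀₂(f)` (`S₀₀ S₂₂ = 1`). [folklore] -/
private theorem kgt_S_mul_far_mul_S {R : Type*} [CommRing R] (f : R) :
    Matrix.diagonal ![(1 : R), -1, 1] * Matrix.transvection (0 : Fin 3) 2 f *
      Matrix.diagonal ![(1 : R), -1, 1] = Matrix.transvection (0 : Fin 3) 2 f := by
  ext k l
  fin_cases k <;> fin_cases l <;>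
    simp [Matrix.transvection, Matrix.mul_apply, Fin.sum_univ_three, Matrix.one_apply]

/-- The `(0, 2)` entry of `S E_ij(a) S` is `a` if `(i, j) = (0, 2)` and `0` otherwise. [folklore] -/
private theorem kgt_S_T_S_apply02 {R : Type*} [CommRing R] (i j : Fin 3) (a : R) :
    (Matrix.diagonal ![(1 : R), -1, 1] * Matrix.transvection i j a *
      Matrix.diagonal ![(1 : R), -1, 1]) 0 2 = if i = 0 ∧ j = 2 then a else 0 := by
  fin_cases i <;> fin_cases j <;>
    simp [Matrix.transvection, Matrix.mul_apply, Fin.sum_univ_three, Matrix.one_apply]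

/-- In a monoid: if every `T` in a list satisfies `T S T = S`, then
`(∏ Ts) S (∏ Ts.reverse) = S` and `(∏ Ts.reverse) S (∏ Ts) = S` (for `S² = 1` this says that
`S (∏ Ts.reverse) S` is the two-sided inverse of `∏ Ts`). [folklore] -/
private theorem kgt_prod_mul_S_mul_rev {M : Type*} [Monoid M] (S : M) (Ts : List M)
    (h : ∀ T ∈ Ts, T * S * T = S) :
    Ts.prod * S * Ts.reverse.prod = S ∧ Ts.reverse.prod * S * Ts.prod = S := by
  induction Ts with
  | nil => simp
  | cons T Ts ih =>
    have hT := h T (by simp)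
    obtain ⟨ih1, ih2⟩ := ih (fun U hU => h U (by simp [hU]))
    simp only [List.prod_cons, List.reverse_cons, List.prod_append, List.prod_nil, mul_one]
    constructor
    · calc T * Ts.prod * S * (Ts.reverse.prod * T)
          = T * (Ts.prod * S * Ts.reverse.prod) * T := by simp only [mul_assoc]
        _ = S := by rw [ih1, hT]
    · calc Ts.reverse.prod * T * S * (T * Ts.prod)
          = Ts.reverse.prod * (T * S * T) * Ts.prod := by simp only [mul_assoc]
        _ = S := by rw [hT, ih2]

/-! ## FACT B: isolating the exit letter -/

/-- FACT B (in a monoid, `S² = 1`): if `(∏ Ts₀) T (∏ Ts₁) = E` with `U S U = S` for every `U` in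
`Ts₀`, `Ts₁`, then `S T S = (∏ Ts₀.reverse) (S E S) (∏ Ts₁.reverse)`. [folklore] -/
private theorem kgt_isolate {M : Type*} [Monoid M] (S : M) (hSS : S * S = 1) (Ts0 Ts1 : List M)
    (T E : M) (h0 : ∀ U ∈ Ts0, U * S * U = S) (h1 : ∀ U ∈ Ts1, U * S * U = S)
    (h : Ts0.prod * (T * Ts1.prod) = E) :
    S * T * S = Ts0.reverse.prod * (S * E * S) * Ts1.reverse.prod := by
  obtain ⟨-, hA0⟩ := kgt_prod_mul_S_mul_rev S Ts0 h0
  obtain ⟨hA1, -⟩ := kgt_prod_mul_S_mul_rev S Ts1 h1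
  have hL : S * Ts0.reverse.prod * S * Ts0.prod = 1 := by
    calc S * Ts0.reverse.prod * S * Ts0.prod
        = S * (Ts0.reverse.prod * S * Ts0.prod) := by simp only [mul_assoc]
      _ = 1 := by rw [hA0, hSS]
  have hR : Ts1.prod * S * Ts1.reverse.prod * S = 1 := by rw [hA1, hSS]
  calc S * T * S
      = S * ((S * Ts0.reverse.prod * S * Ts0.prod) * T *
          (Ts1.prod * S * Ts1.reverse.prod * S)) * S := by rw [hL, hR, one_mul, mul_one]
    _ = (S * S) * Ts0.reverse.prod * (S * (Ts0.prod * (T * Ts1.prod)) * S) *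
          Ts1.reverse.prod * (S * S) := by simp only [mul_assoc]
    _ = Ts0.reverse.prod * (S * E * S) * Ts1.reverse.prod := by rw [h, hSS, one_mul, mul_one]

/-! ## FACT C: coefficientwise-nonnegative matrices -/

/-- Products of coefficientwise-nonnegative polynomials are coefficientwise nonnegative. [folklore] -/
private theorem kgt_coeff_mul_nonneg {σ : Type*} {p q : MvPolynomial σ ℝ}
    (hp : ∀ m, 0 ≤ p.coeff m) (hq : ∀ m, 0 ≤ q.coeff m) (m : σ →₀ ℕ) :
    0 ≤ (p * q).coeff m := by
  classical
  rw [MvPolynomial.coeff_mul]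
  exact Finset.sum_nonneg fun x _ => mul_nonneg (hp _) (hq _)

/-- Products of coefficientwise-nonnegative matrices are coefficientwise nonnegative. [folklore] -/
private theorem kgt_mat_mul_nonneg {σ : Type*} {M N : Matrix (Fin 3) (Fin 3) (MvPolynomial σ ℝ)}
    (hM : ∀ i j m, 0 ≤ (M i j).coeff m) (hN : ∀ i j m, 0 ≤ (N i j).coeff m)
    (i j : Fin 3) (m : σ →₀ ℕ) : 0 ≤ ((M * N) i j).coeff m := by
  rw [Matrix.mul_apply, MvPolynomial.coeff_sum]
  exact Finset.sum_nonneg fun k _ => kgt_coeff_mul_nonneg (hM i k) (hN k j) m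

/-- If `T - 1` is coefficientwise nonnegative for every `T` in a list, then so is `∏ T - 1`
(`AB - 1 = (A - 1)(B - 1) + (A - 1) + (B - 1)`). [folklore] -/
private theorem kgt_prod_sub_one_nonneg {σ : Type*}
    (Ts : List (Matrix (Fin 3) (Fin 3) (MvPolynomial σ ℝ)))
    (h : ∀ T ∈ Ts, ∀ i j m, 0 ≤ ((T - 1) i j).coeff m) :
    ∀ i j m, 0 ≤ ((Ts.prod - 1) i j).coeff m := by
  refine List.prod_induction
    (fun T : Matrix (Fin 3) (Fin 3) (MvPolynomial σ ℝ) => ∀ i j m, 0 ≤ ((T - 1) i j).coeff m) ?_ ?_ h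
  · intro A B hA hB i j m
    have hAB : A * B - 1 = (A - 1) * (B - 1) + (A - 1) + (B - 1) := by noncomm_ring
    rw [hAB, Matrix.add_apply, Matrix.add_apply, MvPolynomial.coeff_add, MvPolynomial.coeff_add]
    exact add_nonneg (add_nonneg (kgt_mat_mul_nonneg hA hB i j m) (hA i j m)) (hB i j m)
  · intro i j m
    simp

/-- A POSITIVE letter `E_ij(c)` / `E_ij(c x_v)`, `c > 0`, is `1 +` (coefficientwise nonnegative).
[folklore] -/
private theorem kgt_letter_sub_one_nonneg {σ : Type*} (i j : Fin 3) (c : ℝ) (hc : 0 < c)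
    (o : Option σ) (i' j' : Fin 3) (m : σ →₀ ℕ) :
    0 ≤ ((Matrix.transvection i j (MvPolynomial.C c * o.elim 1 MvPolynomial.X) - 1 :
      Matrix (Fin 3) (Fin 3) (MvPolynomial σ ℝ)) i' j').coeff m := by
  classical
  rw [Matrix.transvection, add_sub_cancel_left, Matrix.single_apply]
  split_ifs
  · rw [MvPolynomial.coeff_C_mul]
    refine mul_nonneg hc.le ?_
    cases o with
    | none => simp only [Option.elim_none, MvPolynomial.coeff_one]; split_ifs <;> norm_num
    | some v => simp only [Option.elim_some, MvPolynomial.coeff_X]; split_ifs <;> norm_num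
  · simp

/-- The target `E₀₂(per_n)` is coefficientwise nonnegative. [folklore] -/
private theorem kgt_far_per_nonneg (n : ℕ) (i j : Fin 3) (m : (Fin n × Fin n) →₀ ℕ) :
    0 ≤ ((Matrix.transvection (0 : Fin 3) 2 (perPoly (Fin n) ℝ)) i j).coeff m := by
  classical
  rw [Matrix.transvection, Matrix.add_apply, Matrix.one_apply, Matrix.single_apply,
    MvPolynomial.coeff_add]
  refine add_nonneg ?_ ?_
  · split_ifs
    · rw [MvPolynomial.coeff_one]; split_ifs <;> norm_num
    · simp
  · split_ifs
    · rw [coeff_perPoly]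
      exact Finset.sum_nonneg fun ρ _ => by split_ifs <;> norm_num
    · simp

/-- FACT C: if `R₀ - 1`, `E`, `R₁ - 1` are coefficientwise nonnegative then every coefficient of
every entry of `R₀ E R₁ = E + (R₀ - 1) E + E (R₁ - 1) + (R₀ - 1) E (R₁ - 1)` dominates the
corresponding coefficient of `E`. [folklore] -/
private theorem kgt_coeff_le_conj {σ : Type*} (R0 E R1 : Matrix (Fin 3) (Fin 3) (MvPolynomial σ ℝ))
    (h0 : ∀ i j m, 0 ≤ ((R0 - 1) i j).coeff m) (hE : ∀ i j m, 0 ≤ (E i j).coeff m)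
    (h1 : ∀ i j m, 0 ≤ ((R1 - 1) i j).coeff m) (i j : Fin 3) (m : σ →₀ ℕ) :
    (E i j).coeff m ≤ ((R0 * E * R1) i j).coeff m := by
  have hdec : R0 * E * R1 = E + ((R0 - 1) * E + E * (R1 - 1) + (R0 - 1) * E * (R1 - 1)) := by
    noncomm_ring
  rw [hdec, Matrix.add_apply, MvPolynomial.coeff_add, le_add_iff_nonneg_right, Matrix.add_apply,
    Matrix.add_apply, MvPolynomial.coeff_add, MvPolynomial.coeff_add]
  exact add_nonneg (add_nonneg (kgt_mat_mul_nonneg h0 hE i j m) (kgt_mat_mul_nonneg hE h1 i j m))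
    (kgt_mat_mul_nonneg (kgt_mat_mul_nonneg h0 hE) h1 i j m)

/-! ## FACT D: the diagonal permutation monomial -/

/-- The diagonal monomial `x₀₀ x₁₁ ⋯` has degree `n`. [folklore] -/
private theorem kgt_degree_permMonomial_one (n : ℕ) :
    Finsupp.degree (permMonomial (1 : Equiv.Perm (Fin n))) = n := by
  rw [permMonomial, map_sum]
  simp

/-- A letter entry `c` or `c x_v` has no monomial of degree `≥ 2`. [folklore] -/
private theorem kgt_coeff_letter_eq_zero {σ : Type*} (c : ℝ) (o : Option σ) (m : σ →₀ ℕ)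
    (hm : 2 ≤ Finsupp.degree m) :
    (MvPolynomial.C c * o.elim 1 MvPolynomial.X : MvPolynomial σ ℝ).coeff m = 0 := by
  classical
  rw [MvPolynomial.coeff_C_mul]
  cases o with
  | none =>
    simp only [Option.elim_none, MvPolynomial.coeff_one]
    rw [if_neg, mul_zero]
    rintro rfl
    simp at hm
  | some v =>
    simp only [Option.elim_some, MvPolynomial.coeff_X]
    rw [if_neg, mul_zero]
    rintro rfl
    simp at hm

/-! ## Splitting a word with at most one exit -/

/-- A nonempty list with at most one element satisfying `f` splits as `p₀ ++ L :: p₁` with no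
element of `p₀`, `p₁` satisfying `f`. [folklore] -/
private theorem kgt_split {α : Type*} (f : α → Bool) (w : List α) (hw : (w.filter f).length < 2) :
    w = [] ∨ ∃ (p0 : List α) (L : α) (p1 : List α), w = p0 ++ L :: p1 ∧
      (∀ l ∈ p0, f l = false) ∧ (∀ l ∈ p1, f l = false) := by
  by_cases h : ∃ L ∈ w, f L = true
  · obtain ⟨L, hL, hfL⟩ := h
    obtain ⟨s, t, rfl⟩ := List.append_of_mem hL
    rw [List.filter_append, List.filter_cons_of_pos hfL, List.length_append,
      List.length_cons] at hw
    have hs : (s.filter f).length = 0 := by omega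
    have ht : (t.filter f).length = 0 := by omega
    rw [List.length_eq_zero_iff, List.filter_eq_nil_iff] at hs ht
    exact Or.inr ⟨s, L, t, rfl, fun l hl => by simpa using hs l hl,
      fun l hl => by simpa using ht l hl⟩
  · push Not at h
    rcases w with _ | ⟨L, t⟩
    · exact Or.inl rfl
    · exact Or.inr ⟨[], L, t, rfl, fun l hl => by simp at hl,
        fun l hl => by simpa using h l (List.mem_cons_of_mem _ hl)⟩

/-! ## The stub -/

/-- **Rung 1 of the sign budget** (calibration stub `stub_kappaGeTwo` of line
`positive-monoid-exits`): for `n ≥ 2`, every real affine elementary word of width 3 computing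
`E₀₂(per_n)` has at least two EXITS, i.e. at least two letters that are not (positive coefficient
and adjacent).  Proof: FACT A–D of the module docstring (isolate the unique exit by the
`S`-conjugated reversed stretches, compare the coefficient of the diagonal permutation monomial at
entry `(0, 2)`: `0 ≥ 1`).  The validity hypothesis `hw` is not needed.  Sharp: `E₀₂(per₁)` is one
far letter.  Background: `S P⁻¹ S` of a positive stretch `P` is Fallat–Johnson 2011, Thm 1.3.3;
elementary words for polynomials are Ben-Or–Cleve 1992. [cite: BenOrCleve1992, Thm 1] -/
theorem stub_kappaGeTwo (n : ℕ) (hn : 2 ≤ n) (w : List (Fin 3 × Fin 3 × ℝ × Option (Fin n × Fin n)))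
    (hw : ∀ l ∈ w, l.1 ≠ l.2.1)
    (hper : (w.map (fun l => Matrix.transvection l.1 l.2.1
        (MvPolynomial.C l.2.2.1 * l.2.2.2.elim 1 MvPolynomial.X))).prod =
        Matrix.transvection (0 : Fin 3) 2 (perPoly (Fin n) ℝ)) :
    2 ≤ (w.filter (fun l => !decide (0 < l.2.2.1 ∧
          (l.1.val + 1 = l.2.1.val ∨ l.2.1.val + 1 = l.1.val)))).length := by
  by_contra hlt
  push Not at hlt
  -- the diagonal monomial `m₀ = x₀₀ ⋯ x_{n-1,n-1}` of `per_n`, of degree `n ≥ 2`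
  set m₀ : (Fin n × Fin n) →₀ ℕ := permMonomial (1 : Equiv.Perm (Fin n)) with hm₀
  have hdeg : 2 ≤ Finsupp.degree m₀ := by rw [hm₀, kgt_degree_permMonomial_one]; exact_mod_cast hn
  have hE02 : ((Matrix.transvection (0 : Fin 3) 2 (perPoly (Fin n) ℝ)) 0 2).coeff m₀ = 1 := by
    simp [Matrix.transvection, hm₀, coeff_permMonomial_perPoly]
  rcases kgt_split _ w hlt with rfl | ⟨p0, L, p1, rfl, hp0, hp1⟩
  · -- the empty word computes `1 ≠ E₀₂(per_n)`
    rw [List.map_nil, List.prod_nil] at hper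
    have h : ((1 : Matrix (Fin 3) (Fin 3) (MvPolynomial (Fin n × Fin n) ℝ)) 0 2).coeff m₀ =
        ((Matrix.transvection (0 : Fin 3) 2 (perPoly (Fin n) ℝ)) 0 2).coeff m₀ :=
      congrArg (fun M : Matrix (Fin 3) (Fin 3) (MvPolynomial (Fin n × Fin n) ℝ) =>
        (M 0 2).coeff m₀) hper
    rw [hE02, Matrix.one_apply_ne (by decide), MvPolynomial.coeff_zero] at h
    exact zero_ne_one h
  · simp only [Bool.not_eq_false', decide_eq_true_eq] at hp0 hp1
    simp only [List.map_append, List.map_cons, List.prod_append, List.prod_cons] at hper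
    have hB := kgt_isolate (Matrix.diagonal ![(1 : MvPolynomial (Fin n × Fin n) ℝ), -1, 1])
      kgt_S_mul_S _ _ _ _ (fun U hU => ?_) (fun U hU => ?_) hper
    rotate_left
    · obtain ⟨l, hl, rfl⟩ := List.mem_map.1 hU
      exact kgt_adj_mul_S_mul_adj _ _ (hp0 l hl).2 _
    · obtain ⟨l, hl, rfl⟩ := List.mem_map.1 hU
      exact kgt_adj_mul_S_mul_adj _ _ (hp1 l hl).2 _
    rw [kgt_S_mul_far_mul_S] at hB
    have key := congrArg (fun M : Matrix (Fin 3) (Fin 3) (MvPolynomial (Fin n × Fin n) ℝ) =>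
      (M 0 2).coeff m₀) hB
    rw [kgt_S_T_S_apply02] at key
    -- left-hand side: the exit letter has no monomial of degree `n ≥ 2` at entry `(0, 2)`
    have hL0 : ((if L.1 = 0 ∧ L.2.1 = 2 then
        MvPolynomial.C L.2.2.1 * L.2.2.2.elim 1 MvPolynomial.X else 0 :
          MvPolynomial (Fin n × Fin n) ℝ)).coeff m₀ = 0 := by
      split_ifs
      · exact kgt_coeff_letter_eq_zero _ _ _ hdeg
      · exact MvPolynomial.coeff_zero _
    -- right-hand side: dominated from below by the coefficient `1` of `m₀` in `per_n`
    have hR1 : 1 ≤ ((((p0.map (fun l => Matrix.transvection l.1 l.2.1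
        (MvPolynomial.C l.2.2.1 * l.2.2.2.elim 1 MvPolynomial.X))).reverse.prod *
        Matrix.transvection (0 : Fin 3) 2 (perPoly (Fin n) ℝ) *
        (p1.map (fun l => Matrix.transvection l.1 l.2.1
        (MvPolynomial.C l.2.2.1 * l.2.2.2.elim 1 MvPolynomial.X))).reverse.prod) 0 2).coeff m₀) := by
      rw [← hE02]
      refine kgt_coeff_le_conj _ _ _ ?_ (kgt_far_per_nonneg n) ?_ 0 2 m₀
      · refine kgt_prod_sub_one_nonneg _ fun T hT => ?_
        rw [List.mem_reverse, List.mem_map] at hT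
        obtain ⟨l, hl, rfl⟩ := hT
        exact kgt_letter_sub_one_nonneg _ _ _ (hp0 l hl).1 _
      · refine kgt_prod_sub_one_nonneg _ fun T hT => ?_
        rw [List.mem_reverse, List.mem_map] at hT
        obtain ⟨l, hl, rfl⟩ := hT
        exact kgt_letter_sub_one_nonneg _ _ _ (hp1 l hl).1 _
    rw [hL0] at key
    linarith

end Summit.ValiantsHypothesis.ValiantsHypothesis.Cruxes.WordLengthQP.PositiveMonoidExits

end
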